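import Summits.BirchSwinnertonDyer.BirchSwinnertonDyer.Theorems.ByReductionTypeAtTwoFineSelmerConjAAtTwoAdditivePotGoodEisensteinDoor
import HarnessLib

/-!
# Route `ByReductionTypeAtTwo` (rung K4), crux C1″ `FineSelmerConjAAtTwoAdditivePotGood` (item stmt-BirchSwinnertonDyer-22615):
# CENSUS DOOR STAMPS, part B — (A)₂ for the last seven of the 14 DOOR rows of K4's additive `t = 0` census,
# each from ONE displayed parity bit `2 ∤ #Cl(𝓞 ℚ(β))` and `hLim2`, the splitting of `2` being DECIDED BY THE KERNEL
# (a `--supports 22615` file; seat `bsd-2adic-k4-w1` GEN 4; pen RC-350 «consume the census for the door's row list (14)»)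

HONEST FRAMING (cell `bsd-2adic`, D-0036/D-0054/D-0152): per-class stamps in k4-w2's format; conditional on `hLim2` (Lim 2017 Thm. 3.5 at `2`)
BY NAME and on ONE displayed bit per row (the parity of the class number of the cubic field `ℚ(β) = ℚ(P)`, `β` a root of the row's
`2`-division cubic — PRINT/PARI per field, census value recorded in each docstring, NOT kernel); the row's `r_an = 0` etc. are not used
(statement (A)₂ needs no scope hypothesis). Closes nothing at the `∀`-level; nothing booked; BSD is not proved by any of this.

THE CENSUS: see part A (`…CensusDoorStampsA`) for the 14/30 split of k4-w2's 44 rows; this file carries rows 8–14 of the 14 door rows.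

MECHANISM (kernel). Inert rows: the native cubic `X³ + a₂X² + a₄X + a₆` has odd constant term and odd `a₂ + a₄` ⟹ one prime above `2`
(`…InertDoor`), stamp = `fineSelmerDual_moduleFinite_two_cubicModel_of_odd`. `𝔭³` rows: no TRANSLATE of `β` is an Eisenstein generator (the
root has `2`-adic valuation `2/3`), but the algebraic integer **`π = (β + t)²/2`** (`t ∈ {0, 1}`) is: its cubic `X³ − ½(p′² − 2q′)X² +
¼(q′² − 2p′r′)X − ⅛r′²` (`p′, q′, r′` the coefficients of `β + t`) is integral and EISENSTEIN at `2`, and `ℚ(π) = ℚ(β)` by the explicit inverse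
`β + t = (4/(p′q′ − r′))·(π² − ½(p′² − q′)π − ¼p′r′)` — both identities are `linear_combination`s of the `2`-division relation; then
`…EisensteinDoor`'s `fineSelmerDual_moduleFinite_two_of_eisenstein_pointField` with `hF : ℚ(P) = ℚ(π)`.
Rows here: `333036e1` (𝔭³, d = -37004, Cl = [3]) · `344772d1` (𝔭³, d = -114924, Cl = []) · `365400bs1` (𝔭³, d = -20300, Cl = [3]) · `369900c1` (inert, d = -18495, Cl = []) · `451440ch1` (𝔭³, d = -22572, Cl = [3]) · `474320im1` (inert, d = -2695, Cl = [3]) · `97712e1` (inert, d = -31, Cl = []).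

References: [Lim2017FineSelmer] Thm. 3.5, Lemma 3.2; [CoatesSujatha2005] (A); [Greenberg2001IwasawaPastPresent] Prop. 2.1;
cell files `addL2x/gen5/conjA2_census_j289938_classes.tsv`, `addL2x/gen8/DOOR-ROWS-19098-addL2x-GEN8-conjA-v2.tsv` (kit jobs j289938 / j301920).
-/

set_option autoImplicit false
-- sibling precedent (`…EisensteinDoor.lean`): the directory name repeats the summit name
set_option linter.dupNamespace false

noncomputable section

open scoped Classical IntermediateField NumberField

namespace Summit.BirchSwinnertonDyer.BirchSwinnertonDyer.Theorems.AddKatoTwo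

open WeierstrassCurve Field Polynomial IsDedekindDomain Literature.NumberTheory.EllipticCurves
  Literature.NumberTheory.GaloisRepresentations
  Literature.NumberTheory.IwasawaTheory
  Summit.BirchSwinnertonDyer.BirchSwinnertonDyer.Theorems.AlignedTransportAtTwoTorsionPointField
  Summit.BirchSwinnertonDyer.BirchSwinnertonDyer.Theses.ByReductionTypeAtTwo

/-- The census curve `333036e1`: `y² = x³ + (0)x² + (-2155279148328)x + (-1217876965299202876)` is an elliptic curve. -/
theorem isElliptic_333036e1' : (⟨0, ((0 : ℤ) : ℚ), 0, ((-2155279148328 : ℤ) : ℚ), ((-1217876965299202876 : ℤ) : ℚ)⟩ : WeierstrassCurve ℚ).IsElliptic :=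
  isElliptic_cubicModel _ _ _ (by simp only [Cubic.discr]; norm_num)

/-- **(A)₂ for `333036e1` from ONE parity bit** (2 = 𝔭³ in ℚ(P): the algebraic integer `π = β ^ 2 / 2` — `β` a root of the
`2`-division cubic — is a root of the EISENSTEIN cubic `X³ + (-2155279148328)X² + (1161307051804367256298896)X + (-185403037825799475771728130125833922)` and `ℚ(π) = ℚ(β)`, kernel;
census: `d(ℚ(P)) = -37004`, `Cl = [3]`). Granted `hLim2`; displayed: `2 ∤ #Cl(𝓞 ℚ(β))`.
[cite: Lim2017FineSelmer, §3 Thm. 3.5 and Lemma 3.2] [cite: Greenberg2001IwasawaPastPresent, Prop. 2.1 p. 339] -/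
theorem conjA_two_333036e1_of_oddClassNumber
    (hLim2 : Lim2017.thm35_at_two_fineSelmerDual_moduleFinite_of_classicalMuVanishes_of_le_divisionField_four)
    {β : AlgebraicClosure ℚ} (hβ : aeval β (Cubic.toPoly ⟨1, ((0 : ℤ) : ℚ), ((-2155279148328 : ℤ) : ℚ), ((-1217876965299202876 : ℤ) : ℚ)⟩) = 0)
    (hh : ¬ 2 ∣ Nat.card (ClassGroup (𝓞 (IntermediateField.adjoin ℚ {β}))))
    (κ : ZpExtension ℚ 2) (hκ : κ.IsCyclotomic) :
    haveI := isElliptic_333036e1'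
    ∃ (γ : absoluteGaloisGroup ℚ) (D : (⟨0, ((0 : ℤ) : ℚ), 0, ((-2155279148328 : ℤ) : ℚ), ((-1217876965299202876 : ℤ) : ℚ)⟩ : WeierstrassCurve ℚ).FineSelmerDualData κ γ),
      Module.Finite ℤ_[2] (RestrictScalars ℤ_[2] (IwasawaAlgebra 2) D.X) := by
  haveI := isElliptic_333036e1'
  have hβ' : β ^ 3 + (0 : AlgebraicClosure ℚ) * β ^ 2 + (-2155279148328 : AlgebraicClosure ℚ) * β + (-1217876965299202876 : AlgebraicClosure ℚ) = 0 := by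
    have := hβ
    simp only [Cubic.toPoly, map_one, one_mul, aeval_add, aeval_mul, aeval_C, aeval_X_pow, aeval_X,
      eq_ratCast, Rat.cast_intCast] at this
    push_cast at this
    linear_combination this
  set π : AlgebraicClosure ℚ := algebraMap ℚ (AlgebraicClosure ℚ) (1 / 2 : ℚ) * β ^ 2 with hπdef
  have hπ : aeval π (Cubic.toPoly ⟨1, ((-2155279148328 : ℤ) : ℚ), ((1161307051804367256298896 : ℤ) : ℚ), ((-185403037825799475771728130125833922 : ℤ) : ℚ)⟩) = 0 := by
    simp only [Cubic.toPoly, map_one, one_mul, aeval_add, aeval_mul, aeval_C, aeval_X_pow, aeval_X, eq_ratCast,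
      Rat.cast_intCast]
    rw [hπdef]
    simp only [eq_ratCast]
    push_cast
    linear_combination (((304469241324800719 : AlgebraicClosure ℚ) / 2) + (-269409893541 : AlgebraicClosure ℚ) * β + ((1 : AlgebraicClosure ℚ) / 8) * β ^ 3) * hβ'
  have hadj : IntermediateField.adjoin ℚ {π} = IntermediateField.adjoin ℚ {β} := by
    apply le_antisymm
    · rw [IntermediateField.adjoin_simple_le_iff, hπdef]
      exact mul_mem (algebraMap_mem _ _) (pow_mem (IntermediateField.mem_adjoin_simple_self ℚ β) 2)
    · rw [IntermediateField.adjoin_simple_le_iff]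
      have hβeq : β = algebraMap ℚ (AlgebraicClosure ℚ) (1 / 304469241324800719 : ℚ) * π ^ 2 +
          algebraMap ℚ (AlgebraicClosure ℚ) (-44185476 / 12483875571971 : ℚ) * π + algebraMap ℚ (AlgebraicClosure ℚ) (0 : ℚ) := by
        rw [hπdef]; simp only [eq_ratCast]; push_cast; linear_combination (((-1 : AlgebraicClosure ℚ) / 1217876965299202876) * β) * hβ'
      rw [hβeq]
      have hπmem := IntermediateField.mem_adjoin_simple_self ℚ π
      exact add_mem (add_mem (mul_mem (algebraMap_mem _ _) (pow_mem hπmem 2)) (mul_mem (algebraMap_mem _ _) hπmem))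
        (algebraMap_mem _ _)
  obtain ⟨P₀, hP₀, hP₀eq⟩ := exists_geomTorsion_two_eq_some_root ((0 : ℤ) : ℚ) ((-2155279148328 : ℤ) : ℚ) ((-1217876965299202876 : ℤ) : ℚ) hβ
  have hF : IntermediateField.fixedField (MulAction.stabilizer (absoluteGaloisGroup ℚ) P₀) =
      IntermediateField.adjoin ℚ {π} := by
    rw [fixedField_stabilizer_eq_adjoin_root _ _ _ hβ hP₀eq, hadj]
    -- the two `Algebra ℚ ℚ̄` instance paths agree
    congr 1
  have hh' : ¬ 2 ∣ Nat.card (ClassGroup (𝓞 (IntermediateField.adjoin ℚ {π}))) := by rw [hadj]; exact hh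
  exact fineSelmerDual_moduleFinite_two_of_eisenstein_pointField hLim2 _ hP₀ (p := -2155279148328) (q := 1161307051804367256298896) (r := -185403037825799475771728130125833922)
    (by decide) (by decide) (by decide) (by decide) hπ hF hh' κ hκ

/-- The census curve `344772d1`: `y² = x³ + (0)x² + (274754328)x + (-8752828457932)` is an elliptic curve. -/
theorem isElliptic_344772d1' : (⟨0, ((0 : ℤ) : ℚ), 0, ((274754328 : ℤ) : ℚ), ((-8752828457932 : ℤ) : ℚ)⟩ : WeierstrassCurve ℚ).IsElliptic :=
  isElliptic_cubicModel _ _ _ (by simp only [Cubic.discr]; norm_num)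

/-- **(A)₂ for `344772d1` from ONE parity bit** (2 = 𝔭³ in ℚ(P): the algebraic integer `π = β ^ 2 / 2` — `β` a root of the
`2`-division cubic — is a root of the EISENSTEIN cubic `X³ + (274754328)X² + (18872485188682896)X + (-9576500751748034136714578)` and `ℚ(π) = ℚ(β)`, kernel;
census: `d(ℚ(P)) = -114924`, `Cl = []`). Granted `hLim2`; displayed: `2 ∤ #Cl(𝓞 ℚ(β))`.
[cite: Lim2017FineSelmer, §3 Thm. 3.5 and Lemma 3.2] [cite: Greenberg2001IwasawaPastPresent, Prop. 2.1 p. 339] -/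
theorem conjA_two_344772d1_of_oddClassNumber
    (hLim2 : Lim2017.thm35_at_two_fineSelmerDual_moduleFinite_of_classicalMuVanishes_of_le_divisionField_four)
    {β : AlgebraicClosure ℚ} (hβ : aeval β (Cubic.toPoly ⟨1, ((0 : ℤ) : ℚ), ((274754328 : ℤ) : ℚ), ((-8752828457932 : ℤ) : ℚ)⟩) = 0)
    (hh : ¬ 2 ∣ Nat.card (ClassGroup (𝓞 (IntermediateField.adjoin ℚ {β}))))
    (κ : ZpExtension ℚ 2) (hκ : κ.IsCyclotomic) :
    haveI := isElliptic_344772d1'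
    ∃ (γ : absoluteGaloisGroup ℚ) (D : (⟨0, ((0 : ℤ) : ℚ), 0, ((274754328 : ℤ) : ℚ), ((-8752828457932 : ℤ) : ℚ)⟩ : WeierstrassCurve ℚ).FineSelmerDualData κ γ),
      Module.Finite ℤ_[2] (RestrictScalars ℤ_[2] (IwasawaAlgebra 2) D.X) := by
  haveI := isElliptic_344772d1'
  have hβ' : β ^ 3 + (0 : AlgebraicClosure ℚ) * β ^ 2 + (274754328 : AlgebraicClosure ℚ) * β + (-8752828457932 : AlgebraicClosure ℚ) = 0 := by
    have := hβ
    simp only [Cubic.toPoly, map_one, one_mul, aeval_add, aeval_mul, aeval_C, aeval_X_pow, aeval_X,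
      eq_ratCast, Rat.cast_intCast] at this
    push_cast at this
    linear_combination this
  set π : AlgebraicClosure ℚ := algebraMap ℚ (AlgebraicClosure ℚ) (1 / 2 : ℚ) * β ^ 2 with hπdef
  have hπ : aeval π (Cubic.toPoly ⟨1, ((274754328 : ℤ) : ℚ), ((18872485188682896 : ℤ) : ℚ), ((-9576500751748034136714578 : ℤ) : ℚ)⟩) = 0 := by
    simp only [Cubic.toPoly, map_one, one_mul, aeval_add, aeval_mul, aeval_C, aeval_X_pow, aeval_X, eq_ratCast,
      Rat.cast_intCast]
    rw [hπdef]
    simp only [eq_ratCast]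
    push_cast
    linear_combination (((2188207114483 : AlgebraicClosure ℚ) / 2) + (34344291 : AlgebraicClosure ℚ) * β + ((1 : AlgebraicClosure ℚ) / 8) * β ^ 3) * hβ'
  have hadj : IntermediateField.adjoin ℚ {π} = IntermediateField.adjoin ℚ {β} := by
    apply le_antisymm
    · rw [IntermediateField.adjoin_simple_le_iff, hπdef]
      exact mul_mem (algebraMap_mem _ _) (pow_mem (IntermediateField.mem_adjoin_simple_self ℚ β) 2)
    · rw [IntermediateField.adjoin_simple_le_iff]
      have hβeq : β = algebraMap ℚ (AlgebraicClosure ℚ) (1 / 2188207114483 : ℚ) * π ^ 2 +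
          algebraMap ℚ (AlgebraicClosure ℚ) (137377164 / 2188207114483 : ℚ) * π + algebraMap ℚ (AlgebraicClosure ℚ) (0 : ℚ) := by
        rw [hπdef]; simp only [eq_ratCast]; push_cast; linear_combination (((-1 : AlgebraicClosure ℚ) / 8752828457932) * β) * hβ'
      rw [hβeq]
      have hπmem := IntermediateField.mem_adjoin_simple_self ℚ π
      exact add_mem (add_mem (mul_mem (algebraMap_mem _ _) (pow_mem hπmem 2)) (mul_mem (algebraMap_mem _ _) hπmem))
        (algebraMap_mem _ _)
  obtain ⟨P₀, hP₀, hP₀eq⟩ := exists_geomTorsion_two_eq_some_root ((0 : ℤ) : ℚ) ((274754328 : ℤ) : ℚ) ((-8752828457932 : ℤ) : ℚ) hβ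
  have hF : IntermediateField.fixedField (MulAction.stabilizer (absoluteGaloisGroup ℚ) P₀) =
      IntermediateField.adjoin ℚ {π} := by
    rw [fixedField_stabilizer_eq_adjoin_root _ _ _ hβ hP₀eq, hadj]
    -- the two `Algebra ℚ ℚ̄` instance paths agree
    congr 1
  have hh' : ¬ 2 ∣ Nat.card (ClassGroup (𝓞 (IntermediateField.adjoin ℚ {π}))) := by rw [hadj]; exact hh
  exact fineSelmerDual_moduleFinite_two_of_eisenstein_pointField hLim2 _ hP₀ (p := 274754328) (q := 18872485188682896) (r := -9576500751748034136714578)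
    (by decide) (by decide) (by decide) (by decide) hπ hF hh' κ hκ

/-- The census curve `365400bs1`: `y² = x³ + (0)x² + (-5548912500)x + (-159899227787500)` is an elliptic curve. -/
theorem isElliptic_365400bs1' : (⟨0, ((0 : ℤ) : ℚ), 0, ((-5548912500 : ℤ) : ℚ), ((-159899227787500 : ℤ) : ℚ)⟩ : WeierstrassCurve ℚ).IsElliptic :=
  isElliptic_cubicModel _ _ _ (by simp only [Cubic.discr]; norm_num)

/-- **(A)₂ for `365400bs1` from ONE parity bit** (2 = 𝔭³ in ℚ(P): the algebraic integer `π = β ^ 2 / 2` — `β` a root of the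
`2`-division cubic — is a root of the EISENSTEIN cubic `X³ + (-5548912500)X² + (7697607483164062500)X + (-3195970380879851518144531250)` and `ℚ(π) = ℚ(β)`, kernel;
census: `d(ℚ(P)) = -20300`, `Cl = [3]`). Granted `hLim2`; displayed: `2 ∤ #Cl(𝓞 ℚ(β))`.
[cite: Lim2017FineSelmer, §3 Thm. 3.5 and Lemma 3.2] [cite: Greenberg2001IwasawaPastPresent, Prop. 2.1 p. 339] -/
theorem conjA_two_365400bs1_of_oddClassNumber
    (hLim2 : Lim2017.thm35_at_two_fineSelmerDual_moduleFinite_of_classicalMuVanishes_of_le_divisionField_four)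
    {β : AlgebraicClosure ℚ} (hβ : aeval β (Cubic.toPoly ⟨1, ((0 : ℤ) : ℚ), ((-5548912500 : ℤ) : ℚ), ((-159899227787500 : ℤ) : ℚ)⟩) = 0)
    (hh : ¬ 2 ∣ Nat.card (ClassGroup (𝓞 (IntermediateField.adjoin ℚ {β}))))
    (κ : ZpExtension ℚ 2) (hκ : κ.IsCyclotomic) :
    haveI := isElliptic_365400bs1'
    ∃ (γ : absoluteGaloisGroup ℚ) (D : (⟨0, ((0 : ℤ) : ℚ), 0, ((-5548912500 : ℤ) : ℚ), ((-159899227787500 : ℤ) : ℚ)⟩ : WeierstrassCurve ℚ).FineSelmerDualData κ γ),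
      Module.Finite ℤ_[2] (RestrictScalars ℤ_[2] (IwasawaAlgebra 2) D.X) := by
  haveI := isElliptic_365400bs1'
  have hβ' : β ^ 3 + (0 : AlgebraicClosure ℚ) * β ^ 2 + (-5548912500 : AlgebraicClosure ℚ) * β + (-159899227787500 : AlgebraicClosure ℚ) = 0 := by
    have := hβ
    simp only [Cubic.toPoly, map_one, one_mul, aeval_add, aeval_mul, aeval_C, aeval_X_pow, aeval_X,
      eq_ratCast, Rat.cast_intCast] at this
    push_cast at this
    linear_combination this
  set π : AlgebraicClosure ℚ := algebraMap ℚ (AlgebraicClosure ℚ) (1 / 2 : ℚ) * β ^ 2 with hπdef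
  have hπ : aeval π (Cubic.toPoly ⟨1, ((-5548912500 : ℤ) : ℚ), ((7697607483164062500 : ℤ) : ℚ), ((-3195970380879851518144531250 : ℤ) : ℚ)⟩) = 0 := by
    simp only [Cubic.toPoly, map_one, one_mul, aeval_add, aeval_mul, aeval_C, aeval_X_pow, aeval_X, eq_ratCast,
      Rat.cast_intCast]
    rw [hπdef]
    simp only [eq_ratCast]
    push_cast
    linear_combination (((39974806946875 : AlgebraicClosure ℚ) / 2) + ((-1387228125 : AlgebraicClosure ℚ) / 2) * β + ((1 : AlgebraicClosure ℚ) / 8) * β ^ 3) * hβ'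
  have hadj : IntermediateField.adjoin ℚ {π} = IntermediateField.adjoin ℚ {β} := by
    apply le_antisymm
    · rw [IntermediateField.adjoin_simple_le_iff, hπdef]
      exact mul_mem (algebraMap_mem _ _) (pow_mem (IntermediateField.mem_adjoin_simple_self ℚ β) 2)
    · rw [IntermediateField.adjoin_simple_le_iff]
      have hβeq : β = algebraMap ℚ (AlgebraicClosure ℚ) (1 / 39974806946875 : ℚ) * π ^ 2 +
          algebraMap ℚ (AlgebraicClosure ℚ) (-887826 / 12791938223 : ℚ) * π + algebraMap ℚ (AlgebraicClosure ℚ) (0 : ℚ) := by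
        rw [hπdef]; simp only [eq_ratCast]; push_cast; linear_combination (((-1 : AlgebraicClosure ℚ) / 159899227787500) * β) * hβ'
      rw [hβeq]
      have hπmem := IntermediateField.mem_adjoin_simple_self ℚ π
      exact add_mem (add_mem (mul_mem (algebraMap_mem _ _) (pow_mem hπmem 2)) (mul_mem (algebraMap_mem _ _) hπmem))
        (algebraMap_mem _ _)
  obtain ⟨P₀, hP₀, hP₀eq⟩ := exists_geomTorsion_two_eq_some_root ((0 : ℤ) : ℚ) ((-5548912500 : ℤ) : ℚ) ((-159899227787500 : ℤ) : ℚ) hβ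
  have hF : IntermediateField.fixedField (MulAction.stabilizer (absoluteGaloisGroup ℚ) P₀) =
      IntermediateField.adjoin ℚ {π} := by
    rw [fixedField_stabilizer_eq_adjoin_root _ _ _ hβ hP₀eq, hadj]
    -- the two `Algebra ℚ ℚ̄` instance paths agree
    congr 1
  have hh' : ¬ 2 ∣ Nat.card (ClassGroup (𝓞 (IntermediateField.adjoin ℚ {π}))) := by rw [hadj]; exact hh
  exact fineSelmerDual_moduleFinite_two_of_eisenstein_pointField hLim2 _ hP₀ (p := -5548912500) (q := 7697607483164062500) (r := -3195970380879851518144531250)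
    (by decide) (by decide) (by decide) (by decide) hπ hF hh' κ hκ

/-- The census curve `369900c1`: `y² = x³ + (0)x² + (-302207625)x + (-2022116821875)` is an elliptic curve. -/
theorem isElliptic_369900c1' : (⟨0, ((0 : ℤ) : ℚ), 0, ((-302207625 : ℤ) : ℚ), ((-2022116821875 : ℤ) : ℚ)⟩ : WeierstrassCurve ℚ).IsElliptic :=
  isElliptic_cubicModel _ _ _ (by simp only [Cubic.discr]; norm_num)

/-- **(A)₂ for `369900c1` from ONE parity bit** (2 inert in ℚ(P): the native `2`-division cubic has odd constant term and odd `p + q`, kernel;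
census: `d(ℚ(P)) = -18495`, `Cl = []`). Granted `hLim2`; displayed: `2 ∤ #Cl(𝓞 ℚ(β))` for a root `β` of the `2`-division cubic.
[cite: Lim2017FineSelmer, §3 Thm. 3.5 and Lemma 3.2] [cite: Greenberg2001IwasawaPastPresent, Prop. 2.1 p. 339] -/
theorem conjA_two_369900c1_of_oddClassNumber
    (hLim2 : Lim2017.thm35_at_two_fineSelmerDual_moduleFinite_of_classicalMuVanishes_of_le_divisionField_four)
    {β : AlgebraicClosure ℚ} (hβ : aeval β (Cubic.toPoly ⟨1, ((0 : ℤ) : ℚ), ((-302207625 : ℤ) : ℚ), ((-2022116821875 : ℤ) : ℚ)⟩) = 0)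
    (hh : ¬ 2 ∣ Nat.card (ClassGroup (𝓞 (IntermediateField.adjoin ℚ {β}))))
    (κ : ZpExtension ℚ 2) (hκ : κ.IsCyclotomic) :
    haveI := isElliptic_369900c1'
    ∃ (γ : absoluteGaloisGroup ℚ) (D : (⟨0, ((0 : ℤ) : ℚ), 0, ((-302207625 : ℤ) : ℚ), ((-2022116821875 : ℤ) : ℚ)⟩ : WeierstrassCurve ℚ).FineSelmerDualData κ γ),
      Module.Finite ℤ_[2] (RestrictScalars ℤ_[2] (IwasawaAlgebra 2) D.X) := by
  haveI := isElliptic_369900c1'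
  exact fineSelmerDual_moduleFinite_two_cubicModel_of_odd hLim2 (p := 0) (q := -302207625) (r := -2022116821875) (by decide) (by decide)
    hβ hh κ hκ

/-- The census curve `451440ch1`: `y² = x³ + (0)x² + (-15708708)x + (-23965380468)` is an elliptic curve. -/
theorem isElliptic_451440ch1' : (⟨0, ((0 : ℤ) : ℚ), 0, ((-15708708 : ℤ) : ℚ), ((-23965380468 : ℤ) : ℚ)⟩ : WeierstrassCurve ℚ).IsElliptic :=
  isElliptic_cubicModel _ _ _ (by simp only [Cubic.discr]; norm_num)

/-- **(A)₂ for `451440ch1` from ONE parity bit** (2 = 𝔭³ in ℚ(P): the algebraic integer `π = β ^ 2 / 2` — `β` a root of the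
`2`-division cubic — is a root of the EISENSTEIN cubic `X³ + (-15708708)X² + (61690876757316)X + (-71792432621999487378)` and `ℚ(π) = ℚ(β)`, kernel;
census: `d(ℚ(P)) = -22572`, `Cl = [3]`). Granted `hLim2`; displayed: `2 ∤ #Cl(𝓞 ℚ(β))`.
[cite: Lim2017FineSelmer, §3 Thm. 3.5 and Lemma 3.2] [cite: Greenberg2001IwasawaPastPresent, Prop. 2.1 p. 339] -/
theorem conjA_two_451440ch1_of_oddClassNumber
    (hLim2 : Lim2017.thm35_at_two_fineSelmerDual_moduleFinite_of_classicalMuVanishes_of_le_divisionField_four)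
    {β : AlgebraicClosure ℚ} (hβ : aeval β (Cubic.toPoly ⟨1, ((0 : ℤ) : ℚ), ((-15708708 : ℤ) : ℚ), ((-23965380468 : ℤ) : ℚ)⟩) = 0)
    (hh : ¬ 2 ∣ Nat.card (ClassGroup (𝓞 (IntermediateField.adjoin ℚ {β}))))
    (κ : ZpExtension ℚ 2) (hκ : κ.IsCyclotomic) :
    haveI := isElliptic_451440ch1'
    ∃ (γ : absoluteGaloisGroup ℚ) (D : (⟨0, ((0 : ℤ) : ℚ), 0, ((-15708708 : ℤ) : ℚ), ((-23965380468 : ℤ) : ℚ)⟩ : WeierstrassCurve ℚ).FineSelmerDualData κ γ),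
      Module.Finite ℤ_[2] (RestrictScalars ℤ_[2] (IwasawaAlgebra 2) D.X) := by
  haveI := isElliptic_451440ch1'
  have hβ' : β ^ 3 + (0 : AlgebraicClosure ℚ) * β ^ 2 + (-15708708 : AlgebraicClosure ℚ) * β + (-23965380468 : AlgebraicClosure ℚ) = 0 := by
    have := hβ
    simp only [Cubic.toPoly, map_one, one_mul, aeval_add, aeval_mul, aeval_C, aeval_X_pow, aeval_X,
      eq_ratCast, Rat.cast_intCast] at this
    push_cast at this
    linear_combination this
  set π : AlgebraicClosure ℚ := algebraMap ℚ (AlgebraicClosure ℚ) (1 / 2 : ℚ) * β ^ 2 with hπdef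
  have hπ : aeval π (Cubic.toPoly ⟨1, ((-15708708 : ℤ) : ℚ), ((61690876757316 : ℤ) : ℚ), ((-71792432621999487378 : ℤ) : ℚ)⟩) = 0 := by
    simp only [Cubic.toPoly, map_one, one_mul, aeval_add, aeval_mul, aeval_C, aeval_X_pow, aeval_X, eq_ratCast,
      Rat.cast_intCast]
    rw [hπdef]
    simp only [eq_ratCast]
    push_cast
    linear_combination (((5991345117 : AlgebraicClosure ℚ) / 2) + ((-3927177 : AlgebraicClosure ℚ) / 2) * β + ((1 : AlgebraicClosure ℚ) / 8) * β ^ 3) * hβ'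
  have hadj : IntermediateField.adjoin ℚ {π} = IntermediateField.adjoin ℚ {β} := by
    apply le_antisymm
    · rw [IntermediateField.adjoin_simple_le_iff, hπdef]
      exact mul_mem (algebraMap_mem _ _) (pow_mem (IntermediateField.mem_adjoin_simple_self ℚ β) 2)
    · rw [IntermediateField.adjoin_simple_le_iff]
      have hβeq : β = algebraMap ℚ (AlgebraicClosure ℚ) (1 / 5991345117 : ℚ) * π ^ 2 +
          algebraMap ℚ (AlgebraicClosure ℚ) (-290902 / 221901671 : ℚ) * π + algebraMap ℚ (AlgebraicClosure ℚ) (0 : ℚ) := by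
        rw [hπdef]; simp only [eq_ratCast]; push_cast; linear_combination (((-1 : AlgebraicClosure ℚ) / 23965380468) * β) * hβ'
      rw [hβeq]
      have hπmem := IntermediateField.mem_adjoin_simple_self ℚ π
      exact add_mem (add_mem (mul_mem (algebraMap_mem _ _) (pow_mem hπmem 2)) (mul_mem (algebraMap_mem _ _) hπmem))
        (algebraMap_mem _ _)
  obtain ⟨P₀, hP₀, hP₀eq⟩ := exists_geomTorsion_two_eq_some_root ((0 : ℤ) : ℚ) ((-15708708 : ℤ) : ℚ) ((-23965380468 : ℤ) : ℚ) hβ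
  have hF : IntermediateField.fixedField (MulAction.stabilizer (absoluteGaloisGroup ℚ) P₀) =
      IntermediateField.adjoin ℚ {π} := by
    rw [fixedField_stabilizer_eq_adjoin_root _ _ _ hβ hP₀eq, hadj]
    -- the two `Algebra ℚ ℚ̄` instance paths agree
    congr 1
  have hh' : ¬ 2 ∣ Nat.card (ClassGroup (𝓞 (IntermediateField.adjoin ℚ {π}))) := by rw [hadj]; exact hh
  exact fineSelmerDual_moduleFinite_two_of_eisenstein_pointField hLim2 _ hP₀ (p := -15708708) (q := 61690876757316) (r := -71792432621999487378)
    (by decide) (by decide) (by decide) (by decide) hπ hF hh' κ hκ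

/-- The census curve `474320im1`: `y² = x³ + (-1)x² + (697485584)x + (-3875995995969)` is an elliptic curve. -/
theorem isElliptic_474320im1' : (⟨0, ((-1 : ℤ) : ℚ), 0, ((697485584 : ℤ) : ℚ), ((-3875995995969 : ℤ) : ℚ)⟩ : WeierstrassCurve ℚ).IsElliptic :=
  isElliptic_cubicModel _ _ _ (by simp only [Cubic.discr]; norm_num)

/-- **(A)₂ for `474320im1` from ONE parity bit** (2 inert in ℚ(P): the native `2`-division cubic has odd constant term and odd `p + q`, kernel;
census: `d(ℚ(P)) = -2695`, `Cl = [3]`). Granted `hLim2`; displayed: `2 ∤ #Cl(𝓞 ℚ(β))` for a root `β` of the `2`-division cubic.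
[cite: Lim2017FineSelmer, §3 Thm. 3.5 and Lemma 3.2] [cite: Greenberg2001IwasawaPastPresent, Prop. 2.1 p. 339] -/
theorem conjA_two_474320im1_of_oddClassNumber
    (hLim2 : Lim2017.thm35_at_two_fineSelmerDual_moduleFinite_of_classicalMuVanishes_of_le_divisionField_four)
    {β : AlgebraicClosure ℚ} (hβ : aeval β (Cubic.toPoly ⟨1, ((-1 : ℤ) : ℚ), ((697485584 : ℤ) : ℚ), ((-3875995995969 : ℤ) : ℚ)⟩) = 0)
    (hh : ¬ 2 ∣ Nat.card (ClassGroup (𝓞 (IntermediateField.adjoin ℚ {β}))))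
    (κ : ZpExtension ℚ 2) (hκ : κ.IsCyclotomic) :
    haveI := isElliptic_474320im1'
    ∃ (γ : absoluteGaloisGroup ℚ) (D : (⟨0, ((-1 : ℤ) : ℚ), 0, ((697485584 : ℤ) : ℚ), ((-3875995995969 : ℤ) : ℚ)⟩ : WeierstrassCurve ℚ).FineSelmerDualData κ γ),
      Module.Finite ℤ_[2] (RestrictScalars ℤ_[2] (IwasawaAlgebra 2) D.X) := by
  haveI := isElliptic_474320im1'
  exact fineSelmerDual_moduleFinite_two_cubicModel_of_odd hLim2 (p := -1) (q := 697485584) (r := -3875995995969) (by decide) (by decide)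
    hβ hh κ hκ

/-- The census curve `97712e1`: `y² = x³ + (-1)x² + (-6717174)x + (-6698582353)` is an elliptic curve. -/
theorem isElliptic_97712e1' : (⟨0, ((-1 : ℤ) : ℚ), 0, ((-6717174 : ℤ) : ℚ), ((-6698582353 : ℤ) : ℚ)⟩ : WeierstrassCurve ℚ).IsElliptic :=
  isElliptic_cubicModel _ _ _ (by simp only [Cubic.discr]; norm_num)

/-- **(A)₂ for `97712e1` from ONE parity bit** (2 inert in ℚ(P): the native `2`-division cubic has odd constant term and odd `p + q`, kernel;
census: `d(ℚ(P)) = -31`, `Cl = []`). Granted `hLim2`; displayed: `2 ∤ #Cl(𝓞 ℚ(β))` for a root `β` of the `2`-division cubic.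
[cite: Lim2017FineSelmer, §3 Thm. 3.5 and Lemma 3.2] [cite: Greenberg2001IwasawaPastPresent, Prop. 2.1 p. 339] -/
theorem conjA_two_97712e1_of_oddClassNumber
    (hLim2 : Lim2017.thm35_at_two_fineSelmerDual_moduleFinite_of_classicalMuVanishes_of_le_divisionField_four)
    {β : AlgebraicClosure ℚ} (hβ : aeval β (Cubic.toPoly ⟨1, ((-1 : ℤ) : ℚ), ((-6717174 : ℤ) : ℚ), ((-6698582353 : ℤ) : ℚ)⟩) = 0)
    (hh : ¬ 2 ∣ Nat.card (ClassGroup (𝓞 (IntermediateField.adjoin ℚ {β}))))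
    (κ : ZpExtension ℚ 2) (hκ : κ.IsCyclotomic) :
    haveI := isElliptic_97712e1'
    ∃ (γ : absoluteGaloisGroup ℚ) (D : (⟨0, ((-1 : ℤ) : ℚ), 0, ((-6717174 : ℤ) : ℚ), ((-6698582353 : ℤ) : ℚ)⟩ : WeierstrassCurve ℚ).FineSelmerDualData κ γ),
      Module.Finite ℤ_[2] (RestrictScalars ℤ_[2] (IwasawaAlgebra 2) D.X) := by
  haveI := isElliptic_97712e1'
  exact fineSelmerDual_moduleFinite_two_cubicModel_of_odd hLim2 (p := -1) (q := -6717174) (r := -6698582353) (by decide) (by decide)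
    hβ hh κ hκ


end Summit.BirchSwinnertonDyer.BirchSwinnertonDyer.Theorems.AddKatoTwo

end
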